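import Literature.MathematicalPhysics.QuantumLattice.HubbardTTPrimeGrandCanonicalBrackets
import Literature.MathematicalPhysics.QuantumLattice.HubbardOneBodyKinematicRows
import HarnessLib

/-!
# The grand-canonical ground-state energy density of the `t–t'` Hubbard model on `ℤ²`
# (the Legendre transform of `energyDensityTT'` in the density): joint concavity in `(t, t', U, μ)`,
# Lipschitz constants, the variational principle over translation-invariant states, Fenchel–Moreau

Family `hubbard` (topic `MathematicalPhysics/QuantumLattice`); the definition behind the "`μ`-floors" of
`HubbardTTPrimeChemicalPotentialFloors` / `…GrandCanonicalBrackets` (seat `hubbard-box-p1`, stage S2 of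
the Hubbard material oracle: certified words over `(U, t', μ)`-cells). With
`e(t,t',U,n) = energyDensityTT' t t' U n` the canonical ground-state energy density (convex in `n` on
`[0, 2)`, jointly concave in `(t, t', U)` on `U ≥ 0`), the **grand-canonical ground-state energy density**
(zero-temperature grand potential per site) is

  `p(t, t', U, μ) = gcEnergyDensityTT' t t' U μ = inf_{0 ≤ m < 2} ( e(t,t',U,m) − μ·m )`

(Ruelle 1969 §3.4: the grand-canonical thermodynamic function is the Legendre transform of the canonical
one in the density). A real `c` is a `μ`-floor of the companion files iff `c ≤ p` (`le_gcEnergyDensityTT'_iff`).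

* §1 the definition; `p ≤ e(m) − μ m` (`gcEnergyDensityTT'_add_mul_le`), `c ≤ p ↔ μ-floor`, an explicit
  a-priori floor `−16(|t| + |t'|)/π² − 2|μ| ≤ p` (the two bathtub rows of `HubbardOneBodyKinematicRows`).
* §2 THE VARIATIONAL PRINCIPLE, grand-canonical form: `p` is the greatest lower bound of
  `e_Φ(ω) − μ ρ(ω)` over the translation-invariant states `ω` on `ℤ²` of density in `(0,2)`
  (`isGLB_gcEnergyDensityTT'_isTranslationInvariant`; the endpoint `m = 0` of the defining infimum is
  recovered from the interior by convexity) — what a translation-invariant-state relaxation with a density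
  multiplier bounds from below.
* §3 JOINT CONCAVITY: `(t, t', U, μ) ↦ p` is concave on `{U ≥ 0} ⊆ ℝ⁴`
  (`concaveOn_gcEnergyDensityTT'_couplings`), hence in `(t', U, μ)` and in the two parameters `(U, μ)`
  (`concaveOn_gcEnergyDensityTT'_tPrime_U_mu`, `concaveOn_gcEnergyDensityTT'_U_mu`) — an infimum of the
  jointly concave `e(·,·,·,m) − μ m`. MONOTONICITY: non-decreasing in `U`, non-increasing in `μ`.
  LIPSCHITZ: `|Δp| ≤ 2|Δμ|`, `|Δp| ≤ |ΔU|`, `|Δp| ≤ 8|Δt'|` (Israel 1979 Thm. I.3.4: the pressure is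
  `1`-Lipschitz in the interaction norm; here `‖μN‖ = 2|μ|`, `‖U D‖ = |U|`, `‖t'T'‖ = 8|t'|` per site).
* §4 FENCHEL–MOREAU: at every interior density `e(t,t',U,n) = max_μ (p(μ) + μ n)`
  (`exists_gcEnergyDensityTT'_add_mul_eq`, `energyDensityTT'_eq_ciSup_gc`): the canonical energy of a
  material of known filling is recovered exactly from grand-canonical data.
* §5 GROUND STATES: every torus-limit ground state at density `n` attains `p` at some `μ`
  (`IsTorusLimitOf.exists_meanEnergy_sub_eq_gcEnergyDensityTT'`); the TANGENT HYPERPLANE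
  `p(t',U,μ) ≤ p(t'₀,U₀,μ₀) + (U−U₀)·D(ω) + (t'−t'₀)·A(ω) − (μ−μ₀)·n₀` at such an anchor
  (`IsTorusLimitOf.gcEnergyDensityTT'_le_tangent`); and GRIFFITHS' BRACKETS in closed form: a
  translation-invariant grand-canonical minimiser at `μ` has `ρ ≤ (p(μ) − p(μ'))/(μ' − μ)` for `μ' > μ` and
  `ρ ≥ (p(μ') − p(μ))/(μ − μ')` for `μ' < μ` (`IsTranslationInvariant.density_le_slope_gc`,
  `….slope_gc_le_density`).

Design: one real-valued `def` by `sInf` over the image of `[0, 2)` (non-empty; bounded below for `U ≥ 0`,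
`bddBelow_gcSet`); for `U < 0` the canonical `e` is itself a junk `limUnder` and nothing is claimed. Not
here: the identification with the thermodynamic limit of the grand-canonical TORUS ground-state energies
`E₀(H − μN)/L²` (the `t' = 0` torus objects live in `HubbardGrandCanonicalDensity*`), and `T > 0`.

## References

* D. Ruelle, *Statistical Mechanics: Rigorous Results* (1969), §3.4. [cite: Ruelle1969, §3.4]
* R. B. Israel, *Convexity in the Theory of Lattice Gases* (1979), Thm. I.3.4 (`P` convex on the Banach
  space of interactions, `|P(Φ) − P(Ψ)| ≤ ‖Φ − Ψ‖`). [cite: Israel1979, Thm. I.3.4]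
* R. B. Griffiths, Phys. Rev. 152 (1966) 240, §II. [cite: Griffiths1966, §II]
* O. Bratteli, A. Kishimoto, D. W. Robinson, Commun. Math. Phys. 64 (1978) 41, §3 Thm. 2.
  [cite: BratteliKishimotoRobinson1978, §3 Thm. 2]
-/

noncomputable section

namespace Literature.MathematicalPhysics.QuantumLattice

open Matrix Finset HubbardWave0 Literature.Probability.LatticeModels ThermodynamicLimit
open _root_.Filter
open scoped _root_.Topology ComplexOrder BigOperators

namespace ThermodynamicLimit

/-! ### §1 The definition and its defining inequalities -/

/-- **The grand-canonical ground-state energy density of the two-dimensional `t–t'` Hubbard model**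
(zero-temperature grand potential per site) at hoppings `t, t'`, repulsion `U` and chemical potential `μ`:
`p(t,t',U,μ) = inf over densities 0 ≤ m < 2 of (e(t,t',U,m) − μ m)`, the Legendre transform in the density
of Ruelle's canonical energy density `energyDensityTT'` (meaningful for `U ≥ 0`, where the infimum is over a
non-empty set bounded below, `bddBelow_gcSet`). [cite: Ruelle1969, §3.4] -/
def gcEnergyDensityTT' (t t' U μ : ℝ) : ℝ :=
  sInf ((fun m : ℝ => energyDensityTT' t t' U m - μ * m) '' Set.Ico 0 2)

/-- **A-priori floor of the canonical energy density**: `−16(|t| + |t'|)/π² ≤ e(t,t',U,m)` for `U ≥ 0`,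
`0 ≤ m < 2` (monotone in `U` down to `U = 0`, superadditive in the two hoppings, and the two free bathtub
rows `−16|t|/π² ≤ e(t,0,0,m)`, `−16|t'|/π² ≤ e(0,t',0,m)`). [cite: LiebLoss1993, §8, Theorem 8.2] -/
theorem neg_kinetic_le_energyDensityTT' (t t' : ℝ) {U : ℝ} (hU : 0 ≤ U) {m : ℝ} (hm0 : 0 ≤ m)
    (hm2 : m < 2) : -(16 * (|t| + |t'|)) / Real.pi ^ 2 ≤ energyDensityTT' t t' U m := by
  have h0 := energyDensityTT'_mono_U t t' hm0 hm2 le_rfl hU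
  have hadd := energyDensityTT'_add_ge t 0 0 t' (le_refl (0 : ℝ)) (le_refl (0 : ℝ)) hm0 hm2
  rw [add_zero, zero_add, add_zero] at hadd
  have h1 := neg_sixteen_mul_abs_div_pi_sq_le_energyDensityTT' t (le_refl (0 : ℝ)) hm0 hm2
  have h2 := neg_sixteen_mul_abs_div_pi_sq_le_energyDensityTT'_diag t' (le_refl (0 : ℝ)) hm0 hm2
  have e : -(16 * (|t| + |t'|)) / Real.pi ^ 2 = -(16 * |t|) / Real.pi ^ 2 + -(16 * |t'|) / Real.pi ^ 2 := by
    ring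
  rw [e]
  linarith

/-- The defining set `{e(m) − μ m : 0 ≤ m < 2}` is bounded below for `U ≥ 0`, by
`−16(|t| + |t'|)/π² − 2|μ|`. [cite: Ruelle1969, §3.4] -/
theorem bddBelow_gcSet (t t' : ℝ) {U : ℝ} (hU : 0 ≤ U) (μ : ℝ) :
    BddBelow ((fun m : ℝ => energyDensityTT' t t' U m - μ * m) '' Set.Ico 0 2) := by
  refine ⟨-(16 * (|t| + |t'|)) / Real.pi ^ 2 - 2 * |μ|, ?_⟩
  rintro _ ⟨m, ⟨hm0, hm2⟩, rfl⟩
  have h1 := neg_kinetic_le_energyDensityTT' t t' hU hm0 hm2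
  have h2 : μ * m ≤ 2 * |μ| := by
    have := le_abs_self μ
    nlinarith [abs_nonneg μ]
  simp only
  linarith

/-- **`p(μ) ≤ e(m) − μ m`** for every density `0 ≤ m < 2` (`U ≥ 0`). [cite: Ruelle1969, §3.4] -/
theorem gcEnergyDensityTT'_le (t t' : ℝ) {U : ℝ} (hU : 0 ≤ U) (μ : ℝ) {m : ℝ} (hm0 : 0 ≤ m)
    (hm2 : m < 2) : gcEnergyDensityTT' t t' U μ ≤ energyDensityTT' t t' U m - μ * m :=
  csInf_le (bddBelow_gcSet t t' hU μ) ⟨m, ⟨hm0, hm2⟩, rfl⟩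

/-- **`p(μ) + μ n ≤ e(n)`**: `(p(μ), μ)` is a `μ`-floor, for every `μ` (`U ≥ 0`, `0 ≤ n < 2`).
[cite: Ruelle1969, §3.4] -/
theorem gcEnergyDensityTT'_add_mul_le (t t' : ℝ) {U : ℝ} (hU : 0 ≤ U) (μ : ℝ) {n : ℝ} (hn0 : 0 ≤ n)
    (hn2 : n < 2) : gcEnergyDensityTT' t t' U μ + μ * n ≤ energyDensityTT' t t' U n := by
  have h := gcEnergyDensityTT'_le t t' hU μ hn0 hn2
  linarith

/-- **Lower bounds on `p`** (no sign hypothesis): if `c + μ m ≤ e(m)` for all `0 ≤ m < 2` then `c ≤ p(μ)`.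
[cite: Ruelle1969, §3.4] -/
theorem le_gcEnergyDensityTT' {t t' U μ c : ℝ}
    (hc : ∀ m : ℝ, 0 ≤ m → m < 2 → c + μ * m ≤ energyDensityTT' t t' U m) :
    c ≤ gcEnergyDensityTT' t t' U μ := by
  refine le_csInf ⟨_, ⟨0, ⟨le_rfl, two_pos⟩, rfl⟩⟩ ?_
  rintro _ ⟨m, ⟨hm0, hm2⟩, rfl⟩
  have h := hc m hm0 hm2
  simp only
  linarith

/-- **`μ`-floors are exactly the lower bounds on `p`**: for `U ≥ 0`,
`c ≤ p(t,t',U,μ) ↔ ∀ 0 ≤ m < 2, c + μ m ≤ e(t,t',U,m)`. [cite: Ruelle1969, §3.4] -/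
theorem le_gcEnergyDensityTT'_iff (t t' : ℝ) {U : ℝ} (hU : 0 ≤ U) (μ c : ℝ) :
    c ≤ gcEnergyDensityTT' t t' U μ ↔
      ∀ m : ℝ, 0 ≤ m → m < 2 → c + μ * m ≤ energyDensityTT' t t' U m :=
  ⟨fun h m hm0 hm2 => by linarith [gcEnergyDensityTT'_add_mul_le t t' hU μ hm0 hm2],
    le_gcEnergyDensityTT'⟩

/-- The explicit a-priori floor: `−16(|t| + |t'|)/π² − 2|μ| ≤ p(t,t',U,μ)` (`U ≥ 0`).
[cite: LiebLoss1993, §8, Theorem 8.2] -/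
theorem neg_kinetic_sub_le_gcEnergyDensityTT' (t t' : ℝ) {U : ℝ} (hU : 0 ≤ U) (μ : ℝ) :
    -(16 * (|t| + |t'|)) / Real.pi ^ 2 - 2 * |μ| ≤ gcEnergyDensityTT' t t' U μ := by
  refine le_gcEnergyDensityTT' fun m hm0 hm2 => ?_
  have h1 := neg_kinetic_le_energyDensityTT' t t' hU hm0 hm2
  have h2 : μ * m ≤ 2 * |μ| := by
    have := le_abs_self μ
    nlinarith [abs_nonneg μ]
  linarith

/-- `p(μ) ≤ 0`: the empty lattice is admissible (`e(0) ≤ 0`, `energyDensityTT'_density_zero_le`).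
[cite: Ruelle1969, §3.4] -/
theorem gcEnergyDensityTT'_nonpos (t t' : ℝ) {U : ℝ} (hU : 0 ≤ U) (μ : ℝ) :
    gcEnergyDensityTT' t t' U μ ≤ 0 := by
  have h := gcEnergyDensityTT'_le t t' hU μ le_rfl two_pos
  rw [mul_zero, sub_zero] at h
  exact h.trans (energyDensityTT'_density_zero_le t t' hU)

end ThermodynamicLimit

/-! ### §2 The grand-canonical variational principle over translation-invariant states -/

namespace InfVolFermionState

/-- **`p` is below the grand-canonical mean energy of every translation-invariant state**:
`p(t,t',U,μ) ≤ e^{tt'}(ω) − μ ρ(ω)` for `ω` translation invariant with `ρ(ω) ∈ (0,2)` (`U ≥ 0`).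
[cite: BratteliKishimotoRobinson1978, §3 Thm. 2] -/
theorem IsTranslationInvariant.gcEnergyDensityTT'_le_meanEnergy_sub {ω : InfVolFermionState 2}
    (hω : ω.IsTranslationInvariant) (t t' : ℝ) {U : ℝ} (hU : 0 ≤ U) (μ : ℝ) (hρ0 : 0 < ω.density)
    (hρ2 : ω.density < 2) :
    gcEnergyDensityTT' t t' U μ ≤ ω.meanEnergy (hubbardTTPrimeFermionInteraction t t' U) 1 - μ * ω.density :=
  hω.gcFloor_le_meanEnergy_sub t t' hU
    (fun _ hm0 hm2 => gcEnergyDensityTT'_add_mul_le t t' hU μ hm0 hm2) hρ0 hρ2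

/-- **Interior bounds reach the endpoint.** If `c + μ m ≤ e(m)` for all INTERIOR densities `0 < m < 2`
then also at `m = 0`, i.e. `c ≤ e(0)` (convexity: `e(m) ≤ (1 − m) e(0) + m e(1)` for `0 < m ≤ 1`, and
`m → 0⁺`); hence `c ≤ p(μ)`. [cite: Ruelle1969, §3.4] -/
theorem _root_.Literature.MathematicalPhysics.QuantumLattice.ThermodynamicLimit.le_gcEnergyDensityTT'_of_Ioo
    (t t' : ℝ) {U : ℝ} (hU : 0 ≤ U) {μ c : ℝ}
    (hc : ∀ m : ℝ, 0 < m → m < 2 → c + μ * m ≤ energyDensityTT' t t' U m) :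
    c ≤ gcEnergyDensityTT' t t' U μ := by
  refine le_gcEnergyDensityTT' fun m hm0 hm2 => ?_
  rcases hm0.lt_or_eq with hpos | h0
  · exact hc m hpos hm2
  · -- the endpoint `m = 0`
    subst h0
    rw [mul_zero, add_zero]
    set e0 := energyDensityTT' t t' U 0 with he0
    set e1 := energyDensityTT' t t' U 1 with he1
    have hconv := convexOn_energyDensityTT' t t' hU
    -- `e(m) ≤ (1 - m) e(0) + m e(1)` for `m ∈ (0, 1]`
    have hch : ∀ m : ℝ, 0 < m → m ≤ 1 → energyDensityTT' t t' U m ≤ (1 - m) * e0 + m * e1 := by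
      intro m hm hm1
      have h := hconv.2 (show (0 : ℝ) ∈ Set.Ico (0 : ℝ) 2 from ⟨le_rfl, two_pos⟩)
        (show (1 : ℝ) ∈ Set.Ico (0 : ℝ) 2 from ⟨zero_le_one, one_lt_two⟩)
        (show (0 : ℝ) ≤ 1 - m by linarith) hm.le (show (1 - m) + m = 1 by ring)
      simp only [smul_eq_mul, mul_zero, zero_add, mul_one] at h
      exact h
    by_contra hlt
    push Not at hlt
    -- choose `m` small: `m (e1 - e0 - μ) < c - e0`
    obtain ⟨m, hm, hm1, hsmall⟩ : ∃ m : ℝ, 0 < m ∧ m ≤ 1 ∧ m * |e1 - e0 - μ| < c - e0 := by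
      refine ⟨min 1 ((c - e0) / (2 * (|e1 - e0 - μ| + 1))), ?_, min_le_left _ _, ?_⟩
      · exact lt_min one_pos (div_pos (sub_pos.2 hlt) (by positivity))
      · have hA : 0 ≤ |e1 - e0 - μ| := abs_nonneg _
        have hle : min 1 ((c - e0) / (2 * (|e1 - e0 - μ| + 1))) * |e1 - e0 - μ| ≤
            (c - e0) / (2 * (|e1 - e0 - μ| + 1)) * |e1 - e0 - μ| :=
          mul_le_mul_of_nonneg_right (min_le_right _ _) hA
        have hlt2 : (c - e0) / (2 * (|e1 - e0 - μ| + 1)) * |e1 - e0 - μ| < c - e0 := by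
          rw [div_mul_eq_mul_div, div_lt_iff₀ (by positivity)]
          nlinarith [sub_pos.2 hlt]
        exact hle.trans_lt hlt2
    have h1 := hc m hm (by linarith)
    have h2 := hch m hm hm1
    have h3 : m * (e1 - e0 - μ) ≤ m * |e1 - e0 - μ| := mul_le_mul_of_nonneg_left (le_abs_self _) hm.le
    nlinarith

/-- **The grand-canonical variational principle.** For `U ≥ 0`, `p(t,t',U,μ)` is the greatest lower bound
of `e^{tt'}(ω) − μ ρ(ω)` over the translation-invariant infinite-volume states `ω` on `ℤ²` with density in
`(0,2)` — the Bratteli–Kishimoto–Robinson characterisation read for the interaction `Φ(t,t',U) − μ n`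
(below every such state by the canonical variational principle at its density; attained densitywise by the
torus-limit ground states, endpoint by convexity). [cite: BratteliKishimotoRobinson1978, §3 Thm. 2] -/
theorem isGLB_gcEnergyDensityTT'_isTranslationInvariant (t t' : ℝ) {U : ℝ} (hU : 0 ≤ U) (μ : ℝ) :
    IsGLB {E : ℝ | ∃ ω : InfVolFermionState 2, ω.IsTranslationInvariant ∧ 0 < ω.density ∧ ω.density < 2 ∧
      E = ω.meanEnergy (hubbardTTPrimeFermionInteraction t t' U) 1 - μ * ω.density}
      (gcEnergyDensityTT' t t' U μ) := by
  refine ⟨?_, fun c hc => ?_⟩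
  · rintro E ⟨ω, hω, hρ0, hρ2, rfl⟩
    exact hω.gcEnergyDensityTT'_le_meanEnergy_sub t t' hU μ hρ0 hρ2
  · refine le_gcEnergyDensityTT'_of_Ioo t t' hU fun m hm0 hm2 => ?_
    refine (le_energyDensityTT'_iff_forall_isTranslationInvariant t t' hU hm0 hm2 (c + μ * m)).2
      fun ω hω hρ => ?_
    have h := hc ⟨ω, hω, hρ ▸ hm0, hρ ▸ hm2, rfl⟩
    rw [hρ] at h
    linarith

end InfVolFermionState

/-! ### §3 Joint concavity, monotonicity and Lipschitz constants -/

namespace ThermodynamicLimit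

/-- **Joint concavity of `p` in all four parameters `(t, t', U, μ)`** on the half-space `U ≥ 0`: an
infimum over `m` of the jointly concave `(t,t',U) ↦ e(t,t',U,m)` (`concaveOn_energyDensityTT'_couplings`)
minus the linear `μ m`. [cite: Israel1979, Thm. I.3.4] -/
theorem concaveOn_gcEnergyDensityTT'_couplings :
    ConcaveOn ℝ {v : ℝ × ℝ × ℝ × ℝ | 0 ≤ v.2.2.1}
      (fun v => gcEnergyDensityTT' v.1 v.2.1 v.2.2.1 v.2.2.2) := by
  refine ⟨?_, fun x hx y hy a b ha hb hab => ?_⟩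
  · intro x hx y hy a b ha hb _
    simp only [Set.mem_setOf_eq, Prod.snd_add, Prod.smul_snd, Prod.fst_add, Prod.smul_fst,
      smul_eq_mul] at hx hy ⊢
    exact add_nonneg (mul_nonneg ha hx) (mul_nonneg hb hy)
  simp only [Set.mem_setOf_eq] at hx hy
  simp only [smul_eq_mul, Prod.smul_fst, Prod.smul_snd, Prod.fst_add, Prod.snd_add]
  refine le_gcEnergyDensityTT' fun m hm0 hm2 => ?_
  have hxm := gcEnergyDensityTT'_le x.1 x.2.1 hx x.2.2.2 hm0 hm2
  have hym := gcEnergyDensityTT'_le y.1 y.2.1 hy y.2.2.2 hm0 hm2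
  have hx' : ((x.1, x.2.1, x.2.2.1) : ℝ × ℝ × ℝ) ∈ {v : ℝ × ℝ × ℝ | 0 ≤ v.2.2} := hx
  have hy' : ((y.1, y.2.1, y.2.2.1) : ℝ × ℝ × ℝ) ∈ {v : ℝ × ℝ × ℝ | 0 ≤ v.2.2} := hy
  have hJ := (concaveOn_energyDensityTT'_couplings hm0 hm2).2 hx' hy' ha hb hab
  simp only [smul_eq_mul, Prod.smul_mk, Prod.mk_add_mk] at hJ
  nlinarith [mul_le_mul_of_nonneg_left hxm ha, mul_le_mul_of_nonneg_left hym hb]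

/-- **Joint concavity in `(t', U, μ)` at fixed `t`** on `{U ≥ 0} ⊆ ℝ³`. [cite: Israel1979, Thm. I.3.4] -/
theorem concaveOn_gcEnergyDensityTT'_tPrime_U_mu (t : ℝ) :
    ConcaveOn ℝ {v : ℝ × ℝ × ℝ | 0 ≤ v.2.1} (fun v => gcEnergyDensityTT' t v.1 v.2.1 v.2.2) := by
  refine ⟨?_, fun x hx y hy a b ha hb hab => ?_⟩
  · intro x hx y hy a b ha hb _
    simp only [Set.mem_setOf_eq, Prod.snd_add, Prod.smul_snd, Prod.fst_add, Prod.smul_fst,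
      smul_eq_mul] at hx hy ⊢
    exact add_nonneg (mul_nonneg ha hx) (mul_nonneg hb hy)
  have hx' : ((t, x.1, x.2.1, x.2.2) : ℝ × ℝ × ℝ × ℝ) ∈ {v : ℝ × ℝ × ℝ × ℝ | 0 ≤ v.2.2.1} := hx
  have hy' : ((t, y.1, y.2.1, y.2.2) : ℝ × ℝ × ℝ × ℝ) ∈ {v : ℝ × ℝ × ℝ × ℝ | 0 ≤ v.2.2.1} := hy
  have h := concaveOn_gcEnergyDensityTT'_couplings.2 hx' hy' ha hb hab
  simp only [smul_eq_mul, Prod.smul_mk, Prod.mk_add_mk, Prod.smul_fst, Prod.smul_snd, Prod.fst_add,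
    Prod.snd_add] at h ⊢
  have ht : a * t + b * t = t := by rw [← add_mul, hab, one_mul]
  rwa [ht] at h

/-- **Joint concavity in the two parameters `(U, μ)`** at fixed hoppings, on `Set.Ici 0 ×ˢ Set.univ` —
the shape a `(U, μ)`-cell engine consumes ("two-parameter tangent planes lie above, chords below").
[cite: Israel1979, Thm. I.3.4] -/
theorem concaveOn_gcEnergyDensityTT'_U_mu (t t' : ℝ) :
    ConcaveOn ℝ (Set.Ici (0 : ℝ) ×ˢ (Set.univ : Set ℝ)) (fun q : ℝ × ℝ => gcEnergyDensityTT' t t' q.1 q.2) := by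
  refine ⟨(convex_Ici 0).prod convex_univ, fun x hx y hy a b ha hb hab => ?_⟩
  have hx' : ((t', x.1, x.2) : ℝ × ℝ × ℝ) ∈ {v : ℝ × ℝ × ℝ | 0 ≤ v.2.1} :=
    Set.mem_Ici.1 (Set.mem_prod.1 hx).1
  have hy' : ((t', y.1, y.2) : ℝ × ℝ × ℝ) ∈ {v : ℝ × ℝ × ℝ | 0 ≤ v.2.1} :=
    Set.mem_Ici.1 (Set.mem_prod.1 hy).1
  have h := (concaveOn_gcEnergyDensityTT'_tPrime_U_mu t).2 hx' hy' ha hb hab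
  simp only [smul_eq_mul, Prod.smul_mk, Prod.mk_add_mk, Prod.smul_fst, Prod.smul_snd, Prod.fst_add,
    Prod.snd_add] at h ⊢
  have ht : a * t' + b * t' = t' := by rw [← add_mul, hab, one_mul]
  rwa [ht] at h

/-- **Barycentric (Jensen) form**: certified `μ`-floors `cᵢ ≤ p(t, t'ᵢ, Uᵢ, μᵢ)` at anchors with `Uᵢ ≥ 0`
and convex weights give `Σ wᵢ cᵢ ≤ p(t, Σ wᵢ t'ᵢ, Σ wᵢ Uᵢ, Σ wᵢ μᵢ)` — every point of the convex hull of
certified `(t', U, μ)`-corners is certified from below. [cite: Israel1979, Thm. I.3.4] -/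
theorem gcEnergyDensityTT'_ge_sum_lowerBounds (t : ℝ) {ι : Type*} (s : Finset ι) (w tp U μ c : ι → ℝ)
    (hw : ∀ i ∈ s, 0 ≤ w i) (hw1 : ∑ i ∈ s, w i = 1) (hU : ∀ i ∈ s, 0 ≤ U i)
    (hc : ∀ i ∈ s, c i ≤ gcEnergyDensityTT' t (tp i) (U i) (μ i)) :
    ∑ i ∈ s, w i * c i ≤
      gcEnergyDensityTT' t (∑ i ∈ s, w i * tp i) (∑ i ∈ s, w i * U i) (∑ i ∈ s, w i * μ i) := by
  refine le_gcEnergyDensityTT' fun m hm0 hm2 => ?_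
  exact energyDensityTT'_ge_sum_gcFloors t s w tp U c μ hw hw1 hU
    (fun i hi m' hm0' hm2' => (le_gcEnergyDensityTT'_iff t (tp i) (hU i hi) (μ i) (c i)).1 (hc i hi)
      m' hm0' hm2') hm0 hm2

/-- **`p` is non-increasing in `μ`** (densities are non-negative). [cite: Ruelle1969, §3.4] -/
theorem gcEnergyDensityTT'_antitone_mu (t t' : ℝ) {U : ℝ} (hU : 0 ≤ U) {μ μ' : ℝ} (h : μ ≤ μ') :
    gcEnergyDensityTT' t t' U μ' ≤ gcEnergyDensityTT' t t' U μ := by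
  refine le_gcEnergyDensityTT' fun m hm0 hm2 => ?_
  have h1 := gcEnergyDensityTT'_add_mul_le t t' hU μ' hm0 hm2
  nlinarith

/-- **`p` is non-decreasing in `U`** on `U ≥ 0` (`energyDensityTT'_mono_U`). [cite: Ruelle1969, §3.4] -/
theorem gcEnergyDensityTT'_mono_U (t t' : ℝ) {U U' : ℝ} (hU : 0 ≤ U) (h : U ≤ U') (μ : ℝ) :
    gcEnergyDensityTT' t t' U μ ≤ gcEnergyDensityTT' t t' U' μ :=
  le_gcEnergyDensityTT' fun _ hm0 hm2 =>
    gcFloor_mono_U t t' hU h (fun _ hm0' hm2' => gcEnergyDensityTT'_add_mul_le t t' hU μ hm0' hm2') hm0 hm2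

/-- **Lipschitz in `μ` with constant `2`** (the density is at most `2`): `|p(μ) − p(μ')| ≤ 2|μ − μ'|`.
[cite: Israel1979, Thm. I.3.4] -/
theorem abs_gcEnergyDensityTT'_sub_mu_le (t t' : ℝ) {U : ℝ} (hU : 0 ≤ U) (μ μ' : ℝ) :
    |gcEnergyDensityTT' t t' U μ - gcEnergyDensityTT' t t' U μ'| ≤ 2 * |μ - μ'| := by
  have key : ∀ a b : ℝ, gcEnergyDensityTT' t t' U a - 2 * |a - b| ≤ gcEnergyDensityTT' t t' U b := by
    intro a b
    refine le_gcEnergyDensityTT' fun m hm0 hm2 => ?_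
    have h1 := gcEnergyDensityTT'_add_mul_le t t' hU a hm0 hm2
    have h2 : (b - a) * m ≤ 2 * |a - b| := by
      have := le_abs_self (b - a)
      rw [abs_sub_comm] at this
      nlinarith [abs_nonneg (a - b)]
    nlinarith
  have h1 := key μ μ'
  have h2 := key μ' μ
  rw [abs_sub_comm μ' μ] at h2
  rw [abs_le]
  constructor <;> linarith

/-- **Lipschitz in `U` with constant `1`** on `U ≥ 0` (the double-occupancy density is at most `1`; indeed
the slope loss is `(U₀ − U)/2` per unit density, `gcFloor_of_le_U`): `|p(U) − p(U')| ≤ |U − U'|`.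
[cite: Israel1979, Thm. I.3.4] -/
theorem abs_gcEnergyDensityTT'_sub_U_le (t t' : ℝ) {U U' : ℝ} (hU : 0 ≤ U) (hU' : 0 ≤ U') (μ : ℝ) :
    |gcEnergyDensityTT' t t' U μ - gcEnergyDensityTT' t t' U' μ| ≤ |U - U'| := by
  -- downward: `p(V) - (V - W) ≤ p(W)` for `0 ≤ W ≤ V`
  have key : ∀ {V W : ℝ}, 0 ≤ W → W ≤ V →
      gcEnergyDensityTT' t t' V μ - (V - W) ≤ gcEnergyDensityTT' t t' W μ := by
    intro V W hW hWV
    refine le_gcEnergyDensityTT' fun m hm0 hm2 => ?_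
    have h1 := gcFloor_of_le_U t t' hW hWV
      (fun m' hm0' hm2' => gcEnergyDensityTT'_add_mul_le t t' (hW.trans hWV) μ hm0' hm2') hm0 hm2
    nlinarith [sub_nonneg.2 hWV]
  rcases le_total U' U with hle | hle
  · have h1 := key hU' hle
    have h2 := gcEnergyDensityTT'_mono_U t t' hU' hle μ
    rw [abs_of_nonneg (by linarith : 0 ≤ gcEnergyDensityTT' t t' U μ - gcEnergyDensityTT' t t' U' μ),
      abs_of_nonneg (by linarith : 0 ≤ U - U')]
    linarith
  · have h1 := key hU hle
    have h2 := gcEnergyDensityTT'_mono_U t t' hU hle μ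
    rw [abs_of_nonpos (by linarith : gcEnergyDensityTT' t t' U μ - gcEnergyDensityTT' t t' U' μ ≤ 0),
      abs_of_nonpos (by linarith : U - U' ≤ 0)]
    linarith

/-- **Lipschitz in `t'` with constant `8`** (`U ≥ 0`; `4` per unit density, `gcFloor_of_tPrime`):
`|p(s) − p(s')| ≤ 8|s − s'|`. [cite: Israel1979, Thm. I.3.4] -/
theorem abs_gcEnergyDensityTT'_sub_tPrime_le (t : ℝ) {U : ℝ} (hU : 0 ≤ U) (μ s s' : ℝ) :
    |gcEnergyDensityTT' t s U μ - gcEnergyDensityTT' t s' U μ| ≤ 8 * |s - s'| := by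
  have key : ∀ a b : ℝ, gcEnergyDensityTT' t a U μ - 8 * |b - a| ≤ gcEnergyDensityTT' t b U μ := by
    intro a b
    refine le_gcEnergyDensityTT' fun m hm0 hm2 => ?_
    have h1 := gcFloor_of_tPrime t hU (s := a) (s' := b)
      (fun m' hm0' hm2' => gcEnergyDensityTT'_add_mul_le t a hU μ hm0' hm2') hm0 hm2
    nlinarith [abs_nonneg (b - a)]
  have h1 := key s s'
  have h2 := key s' s
  rw [abs_sub_comm s s'] at h2
  rw [abs_sub_comm s s', abs_le]
  constructor <;> linarith

/-! ### §4 Fenchel–Moreau: the canonical energy is recovered at every interior density -/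

/-- **A tight chemical potential at every interior density**: for `U ≥ 0` and `0 < n < 2` there is `μ`
with `p(μ) + μ n = e(t,t',U,n)` (the supporting slope of the convex `e(·)` at `n`, `exists_gcFloor_eq`).
[cite: Ruelle1969, §3.4] -/
theorem exists_gcEnergyDensityTT'_add_mul_eq (t t' : ℝ) {U : ℝ} (hU : 0 ≤ U) {n : ℝ} (hn0 : 0 < n)
    (hn2 : n < 2) : ∃ μ : ℝ, gcEnergyDensityTT' t t' U μ + μ * n = energyDensityTT' t t' U n := by
  obtain ⟨μ, c, hc, hcn⟩ := exists_gcFloor_eq t t' hU hn0 hn2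
  refine ⟨μ, le_antisymm (gcEnergyDensityTT'_add_mul_le t t' hU μ hn0.le hn2) ?_⟩
  have h := le_gcEnergyDensityTT' hc
  linarith

/-- **Fenchel–Moreau**: `e(t,t',U,n) = sup_μ (p(t,t',U,μ) + μ n)` at every interior density `0 < n < 2`
(`U ≥ 0`; the supremum is attained). [cite: Ruelle1969, §3.4] -/
theorem energyDensityTT'_eq_ciSup_gc (t t' : ℝ) {U : ℝ} (hU : 0 ≤ U) {n : ℝ} (hn0 : 0 < n)
    (hn2 : n < 2) :
    energyDensityTT' t t' U n = ⨆ μ : ℝ, (gcEnergyDensityTT' t t' U μ + μ * n) := by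
  have hbdd : BddAbove (Set.range fun μ : ℝ => gcEnergyDensityTT' t t' U μ + μ * n) :=
    ⟨energyDensityTT' t t' U n, by
      rintro _ ⟨μ, rfl⟩
      exact gcEnergyDensityTT'_add_mul_le t t' hU μ hn0.le hn2⟩
  obtain ⟨μ₀, hμ₀⟩ := exists_gcEnergyDensityTT'_add_mul_eq t t' hU hn0 hn2
  refine le_antisymm ?_ (ciSup_le fun μ => gcEnergyDensityTT'_add_mul_le t t' hU μ hn0.le hn2)
  exact le_ciSup_of_le hbdd μ₀ hμ₀.ge

end ThermodynamicLimit

/-! ### §5 Ground states: attainment, the tangent hyperplane, Griffiths' brackets in closed form -/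

namespace InfVolFermionState

/-- **Torus-limit ground states attain `p`.** A torus limit `ω` along `Ls → ∞` of unit ground states of
`hubbardTorusTT' (Ls j) t t' U` in the sectors `(rectN n (Ls j), S^z = 0)` (`U ≥ 0`, `0 < n < 2`) is a
grand-canonical minimiser at some `μ`: `e^{tt'}(ω) − μ n = p(t,t',U,μ)` (and `ρ(ω) = n`).
[cite: BratteliKishimotoRobinson1978, §3 Thm. 2] -/
theorem IsTorusLimitOf.exists_meanEnergy_sub_eq_gcEnergyDensityTT' (t t' : ℝ) {U : ℝ} (hU : 0 ≤ U)
    {n : ℝ} (hn0 : 0 < n) (hn2 : n < 2)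
    {ω : InfVolFermionState 2} {ψ : ∀ L, Fock (Orb (FermionTorus 2 L))} {Ls : ℕ → ℕ}
    (h : ω.IsTorusLimitOf ψ Ls) (hLs : Tendsto Ls atTop atTop)
    (hψ : ∀ j, IsGroundStateInSector (hubbardTorusTT' (Ls j) t t' U) (rectN n (Ls j)) 0 (ψ (Ls j)))
    (h1 : ∀ j, star (ψ (Ls j)) ⬝ᵥ ψ (Ls j) = 1) :
    ∃ μ : ℝ, ω.meanEnergy (hubbardTTPrimeFermionInteraction t t' U) 1 - μ * n =
      gcEnergyDensityTT' t t' U μ := by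
  obtain ⟨μ, hμ⟩ := exists_gcEnergyDensityTT'_add_mul_eq t t' hU hn0 hn2
  refine ⟨μ, ?_⟩
  rw [h.meanEnergy_hubbardTTPrime_eq_energyDensityTT' t t' hU hn0.le hn2 hLs hψ h1]
  linarith

/-- **The tangent hyperplane of `p` at an anchor ground state** (the "two-parameter tangent-plane
lemma", three slopes). Let `ω` be a torus-limit ground state at `(t, t'₀, U₀)` of density `0 ≤ n₀ < 2` (`U₀ ≥ 0`) and
`μ₀` any real. Then for every `t'`, every `U ≥ 0` and every `μ`:
`p(t,t',U,μ) ≤ (e(t,t'₀,U₀,n₀) − μ₀ n₀) + (U − U₀)·D(ω) + (t' − t'₀)·A(ω) − (μ − μ₀)·n₀`, with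
`D(ω) = e^{0,0,1}(ω)` (double occupancy) and `A(ω) = e^{0,1,0}(ω)` (unit diagonal-hopping energy); when
`μ₀` is a chemical potential of `n₀` the constant is `p(t,t'₀,U₀,μ₀)` (`exists_gcEnergyDensityTT'_add_mul_eq`).
One anchor certificate with slope brackets is a `μ`-CEILING over a whole `(t', U, μ)`-region.
[cite: KomaTasaki1994, §1] -/
theorem IsTorusLimitOf.gcEnergyDensityTT'_le_tangent (t t'₀ : ℝ) {U₀ : ℝ} (hU₀ : 0 ≤ U₀) {n₀ : ℝ}
    (hn0 : 0 ≤ n₀) (hn2 : n₀ < 2)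
    {ω : InfVolFermionState 2} {ψ : ∀ L, Fock (Orb (FermionTorus 2 L))} {Ls : ℕ → ℕ}
    (h : ω.IsTorusLimitOf ψ Ls) (hLs : Tendsto Ls atTop atTop)
    (hψ : ∀ j, IsGroundStateInSector (hubbardTorusTT' (Ls j) t t'₀ U₀) (rectN n₀ (Ls j)) 0 (ψ (Ls j)))
    (h1 : ∀ j, star (ψ (Ls j)) ⬝ᵥ ψ (Ls j) = 1) (t' : ℝ) {U : ℝ} (hU : 0 ≤ U) (μ₀ μ : ℝ) :
    gcEnergyDensityTT' t t' U μ ≤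
      (energyDensityTT' t t'₀ U₀ n₀ - μ₀ * n₀) +
        (U - U₀) * ω.meanEnergy (hubbardTTPrimeFermionInteraction 0 0 1) 1 +
          (t' - t'₀) * ω.meanEnergy (hubbardTTPrimeFermionInteraction 0 1 0) 1 - (μ - μ₀) * n₀ :=
  (gcEnergyDensityTT'_le t t' hU μ hn0 hn2).trans
    (h.gcEnergy_le_affine t t'₀ hU₀ hn0 hn2 hLs hψ h1 t' hU μ₀ μ)

/-- **Griffiths' upper bracket in closed form**: a translation-invariant grand-canonical minimiser `ω` at
`μ` (`e^{tt'}(ω) − μ ρ(ω) ≤ p(μ)`, `ρ(ω) ∈ (0,2)`, `U ≥ 0`) has `ρ(ω) ≤ (p(μ) − p(μ'))/(μ' − μ)` for every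
`μ' > μ`. With certified data `p(μ) ≤ R₀ − μ m₀`, `c' ≤ p(μ')` this is
`IsTranslationInvariant.density_le_of_gcMinimal`. [cite: Griffiths1966, §II] -/
theorem IsTranslationInvariant.density_le_slope_gc {ω : InfVolFermionState 2}
    (hω : ω.IsTranslationInvariant) (t t' : ℝ) {U : ℝ} (hU : 0 ≤ U) (hρ0 : 0 < ω.density)
    (hρ2 : ω.density < 2) {μ μ' : ℝ}
    (hgc : ω.meanEnergy (hubbardTTPrimeFermionInteraction t t' U) 1 - μ * ω.density ≤
      gcEnergyDensityTT' t t' U μ) (hμ : μ < μ') :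
    ω.density ≤ (gcEnergyDensityTT' t t' U μ - gcEnergyDensityTT' t t' U μ') / (μ' - μ) := by
  have h' := hω.gcEnergyDensityTT'_le_meanEnergy_sub t t' hU μ' hρ0 hρ2
  rw [le_div_iff₀ (sub_pos.2 hμ)]
  linarith

/-- **Griffiths' lower bracket in closed form**: same data, `μ' < μ` ⇒
`(p(μ') − p(μ))/(μ − μ') ≤ ρ(ω)`. [cite: Griffiths1966, §II] -/
theorem IsTranslationInvariant.slope_gc_le_density {ω : InfVolFermionState 2}
    (hω : ω.IsTranslationInvariant) (t t' : ℝ) {U : ℝ} (hU : 0 ≤ U) (hρ0 : 0 < ω.density)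
    (hρ2 : ω.density < 2) {μ μ' : ℝ}
    (hgc : ω.meanEnergy (hubbardTTPrimeFermionInteraction t t' U) 1 - μ * ω.density ≤
      gcEnergyDensityTT' t t' U μ) (hμ : μ' < μ) :
    (gcEnergyDensityTT' t t' U μ' - gcEnergyDensityTT' t t' U μ) / (μ - μ') ≤ ω.density := by
  have h' := hω.gcEnergyDensityTT'_le_meanEnergy_sub t t' hU μ' hρ0 hρ2
  rw [div_le_iff₀ (sub_pos.2 hμ)]
  linarith

end InfVolFermionState

end Literature.MathematicalPhysics.QuantumLattice

end
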